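import Summits.HodgeConjecture.CorCM.B01.Transposition.Item6CentralTypeAtPin
import Literature.NumberTheory.Automorphic.UnitaryGroupDualPairLine
import Literature.NumberTheory.GelbartRogawski1991.UnitaryDualPairWeilCoinvariantsTwistVanishingComp
import Literature.NumberTheory.GelbartRogawski1991.UnitaryDualPairWeilCoinvariantsReference
import Literature.NumberTheory.GelbartRogawski1991.UnitaryDualPairWeilCoinvariantsSmooth
import Literature.NumberTheory.Automorphic.QuadraticHeckeCharacterCMInfinityType
import Literature.NumberTheory.Automorphic.UnitaryGroupArchCenter
import Literature.NumberTheory.Automorphic.UnitaryLineArchTypes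
import HarnessLib

/-!
# X3-Char item (F), SMOOTH BRANCH, at the COR-CM pin: a compatible pair splitting with smooth finite Weil representation and a
# central type IS CONTINUOUS

Cell pub-hodgecm2 (COR-CM), seat pin-3 (gen 10), 2026-08-23.  Port layer L69 (`LiuIndexCentralType`).  Theorems only.

`continuous_of_hasCentralTypeAt_of_smooth`: at a Gram scalar `a` over the hermitian 3-space `V`, a compatible pair splitting `s` of the
CM pair datum whose finite Weil representation `ω_f ∘ s_pair` is SMOOTH (the `U(V)`-member through any continuous OPEN `ι : G →* U(diag (frameD V))(𝔸_f)`,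
at the pin `ι := ιVE V` on `G := ↥V.adelicFin` — the shape of own-htheta's `Item6BlockVanishing`; the `U(W)`-member directly) and which HAS A
CENTRAL TYPE on the Gaussian
(`LiuIndex.HasCentralTypeAt V a s m`, any `m`) is CONTINUOUS.  Assembly, nothing else:
(1) a CONTINUOUS compatible reference splitting with a central type: Liu's line `ι_{χ₀}` for `χ₀ := toHecke ψ`, `ψ` conjugate symplectic
    of infinity type `(1, …, 1)` (`exists_ideleClassChar_of_isCMField_odd`; `isCompatible_∕continuous_chiSplittingLine`; its central type
    `centralType (1,…,1)` by `Item6CentralTypeAtPin.hasCentralTypeAt_chiSplittingLine`, i.e. mc-theta-3's (o3) table) — no (F1) vacuum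
    character, no `centralTypeOf`, no [GR91, 3.1.1]-existence needed;
(2) the twist normal form `s = ι_{χ₀} ⊗ ĉ` (`WeilCoinv.exists_eq_twist_of_isCompatible`, [Weil64, n° 39]) and, both finite Weil
    representations being smooth (`ι_{χ₀}`: continuity + [BZ76, §2.1] `exists_isOpen_isCompact_forall_finPairRepV_apply_eq_self`; `s`:
    hypothesis, through `ι`), `ĉ ∘ inl ∘ ι` trivial on an open subgroup (own-htheta ✔ `exists_isOpen_forall_twistCharV_comp_eq_one_of_smooth`,
    [GR91, Remark p. 457 L4–13]);
(3) the two central types — `m` for `s` (hypothesis) and `centralType (1,…,1)` for `ι_{χ₀}` — force `ĉ` on the archimedean centre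
    `U(1)(L⁺ ⊗ ℝ) · 1₃` to be the CONTINUOUS character `archWeight L (m − centralType (1,…,1))` (`WeilCoinv.pairRep_twist_apply`,
    `UnitaryGroup.archToAdelic_cmArchCenter`);
(4) automatic continuity of an abstract character of `G₁(𝔸) = U(J_V ⊗ J_W)(𝔸)` with a finite level and a continuous centre
    (mc-theta-3 ✔ `UnitaryGroupAdelicContinuity` + `UnitaryGroupDualPairLine.continuous_pair_of_level_of_continuous_centre`:
    `SU(2,1)`, `SU(3)` perfect; the cube map of the compact divisible torus is a quotient map);
(5) `adelicMpCont.continuous_twist` ([Weil64, n° 39]).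
Consequence (with ✔ `Item6BlockVanishing`: non-smooth ⇒ `block = ⊥`, and the GOOD-character junctions `Item6PlacementJunctionAppendixCGood`):
every index line of the pin at which [Liu2021, Thm. 4.18] has to be cited is CONTINUOUS, hence (X3-Char (E), `Item6CentralTypeAtPin[Index]`)
`= ι_μ` for a `μ` conjugate symplectic of weight one with `Φ_μ` the line's type.  HC_CM is NOT proved here or anywhere; no pointer moves.
-/

set_option autoImplicit false

noncomputable section

namespace Summit.HodgeConjecture.CorCM.Transposition.CentralTypeAtPin

open NumberField NumberField.InfinitePlace NumberField.mixedEmbedding IsDedekindDomain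
open scoped Matrix SchwartzMap Classical TensorProduct
open Literature.NumberTheory.Automorphic Literature.NumberTheory.Automorphic.UnitaryGroup Literature.NumberTheory.Weil1964
open Literature.NumberTheory.GelbartRogawski1991 Literature.NumberTheory.GelbartRogawski1991.UnitaryDualPair
open Literature.NumberTheory.GelbartRogawski1991.GRConstruction
open Literature.NumberTheory.Automorphic.Liu2021.Def411WeilCarriersDoubling
open Literature.NumberTheory.Automorphic.IdeleClassGroup
open HodgeCM HodgeCM.Model HodgeCM.Model.LiuIndex
open HodgeCM.Model.SupplyInstance (testFun)
open HodgeCM.Model.ArchSideTerm (e₁)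

variable {L : CMField} {ι₁ : (L : Type) →+* ℂ} (V : HermSpace3 L ι₁)

set_option maxHeartbeats 4000000 in
/-- **X3-Char item (F), SMOOTH BRANCH: a compatible pair splitting of the line `⟨a⟩` over `V` with SMOOTH finite Weil representation
and a CENTRAL TYPE is CONTINUOUS.**  [cite: GelbartRogawski1991, §3.1 Prop. 3.1.1 p. 455 L1–3, Remark p. 457 L4–13]
[cite: BernsteinZelevinsky1976, §2.1] [cite: Weil1964, Chap. III n° 39 p. 189] -/
theorem continuous_of_hasCentralTypeAt_of_smooth (a : RealScalar L) (s : SplittingAt V a) (hs : IsCompatAtScalar V a s)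
    {m : InfinitePlace (L : Type) → ℤ} (hP : HasCentralTypeAt V a s m)
    {G : Type*} [Group G] [TopologicalSpace G]
    (ι : G →* ↥(UnitaryGroup.finAdelic (↥(maximalRealSubfield (L : Type))) (L : Type) (IsCMField.complexConj (L : Type)) 3
      (Matrix.diagonal (frameD V)))) (hι : Continuous ι) (hιo : IsOpenMap ι)
    (hsmV : ∀ v : FinSB (↥(maximalRealSubfield (L : Type))) (Fin 3 × Fin 1),
      ∃ K : Subgroup G, IsOpen (K : Set G) ∧
        ∀ g ∈ K, UnitaryDualPair.WeilCoinv.finPairRepV (↥(maximalRealSubfield (L : Type))) (L : Type) (IsCMField.complexConj (L : Type)) 3 1 e₁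
          (Matrix.diagonal (frameD V)) (Matrix.diagonal (RealScalar.vec a)) (complexConj_imagUnit (L : Type))
          (imagUnit_ne_zero (L : Type)) (imagUnit_mul_self (L : Type)) (realDiagonal_isSymm (L : Type) (frameD V) (frameD_real V))
          (realDiagonal_isSymm (L : Type) (RealScalar.vec a) (RealScalar.vec_real a))
          (isUnit_det_realDiagonal (L : Type) (frameD V) (frameD_real V) (frameD_ne V))
          (isUnit_det_realDiagonal (L : Type) (RealScalar.vec a) (RealScalar.vec_real a) (RealScalar.vec_ne a))
          (realDiagonal_map (L : Type) (frameD V) (frameD_real V)).symm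
          (realDiagonal_map (L : Type) (RealScalar.vec a) (RealScalar.vec_real a)).symm hs (ι g) v = v)
    (hsmW : ∀ v : FinSB (↥(maximalRealSubfield (L : Type))) (Fin 3 × Fin 1),
      ∃ K : Subgroup ↥(UnitaryGroup.finAdelic (↥(maximalRealSubfield (L : Type))) (L : Type) (IsCMField.complexConj (L : Type)) 1
        (Matrix.diagonal (RealScalar.vec a))),
        IsOpen (K : Set ↥(UnitaryGroup.finAdelic (↥(maximalRealSubfield (L : Type))) (L : Type) (IsCMField.complexConj (L : Type)) 1
          (Matrix.diagonal (RealScalar.vec a)))) ∧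
        ∀ u ∈ K, UnitaryDualPair.WeilCoinv.finPairRepW (↥(maximalRealSubfield (L : Type))) (L : Type) (IsCMField.complexConj (L : Type)) 3 1 e₁
          (Matrix.diagonal (frameD V)) (Matrix.diagonal (RealScalar.vec a)) (complexConj_imagUnit (L : Type))
          (imagUnit_ne_zero (L : Type)) (imagUnit_mul_self (L : Type)) (realDiagonal_isSymm (L : Type) (frameD V) (frameD_real V))
          (realDiagonal_isSymm (L : Type) (RealScalar.vec a) (RealScalar.vec_real a))
          (isUnit_det_realDiagonal (L : Type) (frameD V) (frameD_real V) (frameD_ne V))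
          (isUnit_det_realDiagonal (L : Type) (RealScalar.vec a) (RealScalar.vec_real a) (RealScalar.vec_ne a))
          (realDiagonal_map (L : Type) (frameD V) (frameD_real V)).symm
          (realDiagonal_map (L : Type) (RealScalar.vec a) (RealScalar.vec_real a)).symm hs u v = v) :
    Continuous s := by
  -- (1) a CONTINUOUS compatible reference splitting WITH A CENTRAL TYPE: Liu's line `ι_{χ₀}`, `χ₀ := toHecke ψ` for a conjugate-symplectic
  --     `ψ` of infinity type `(1, …, 1)` ([Liu21, Def. 4.1 ∕ App. D Step 2]; [GR91, Prop. 3.1.1] through (GR-2)'s kernel)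
  obtain ⟨ψ, hψinf, hψcs⟩ := Literature.NumberTheory.Automorphic.exists_ideleClassChar_of_isCMField_odd (L : Type) odd_one
    (fun _ => (1 : ℤ)) (fun _ => Int.ModEq.refl _)
  have hχu := isUnitary_toHeckeCharacter (L : Type) ψ
  have hχs := isSplittingChar_toHeckeCharacter_of_isConjugateSymplectic (L : Type) ψ hψcs
  have hτ : (toHeckeCharacter (L : Type) ψ).HasUnitaryArchType (fun _ => (1 : ℤ)) 0 :=
    (Literature.NumberTheory.Automorphic.IdeleClassGroup.hasUnitaryArchType_toHeckeCharacter_iff (L : Type) ψ _).2 hψinf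
  have hs₀ : IsCompatAtScalar V a
      (chiSplittingLine (L : Type) e₁ (frameD V) (frameD_real V) (frameD_ne V) (toHeckeCharacter (L : Type) ψ) hχu hχs
        (realDiagonal (L : Type) (RealScalar.vec a) (RealScalar.vec_real a))
        (isUnit_det_realDiagonal (L : Type) (RealScalar.vec a) (RealScalar.vec_real a) (RealScalar.vec_ne a))
        (Matrix.diagonal (RealScalar.vec a)) (realDiagonal_map (L : Type) (RealScalar.vec a) (RealScalar.vec_real a)).symm) :=
    isCompatible_chiSplittingLine (L : Type) e₁ (frameD V) (frameD_real V) (frameD_ne V) (toHeckeCharacter (L : Type) ψ) hχu hχs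
      _ (realDiagonal_isSymm (L : Type) (RealScalar.vec a) (RealScalar.vec_real a)) _ _ _
  have hsc₀ := continuous_pairSplitting_chiSplittingLine (L : Type) e₁ (frameD V) (frameD_real V) (frameD_ne V)
    (toHeckeCharacter (L : Type) ψ) hχu hχs (realDiagonal (L : Type) (RealScalar.vec a) (RealScalar.vec_real a))
    (isUnit_det_realDiagonal (L : Type) (RealScalar.vec a) (RealScalar.vec_real a) (RealScalar.vec_ne a))
    (Matrix.diagonal (RealScalar.vec a)) (realDiagonal_map (L : Type) (RealScalar.vec a) (RealScalar.vec_real a)).symm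
  have hP₀ := hasCentralTypeAt_chiSplittingLine V a hχu hχs hτ (fun _ => odd_one)
  -- (2) the twist normal form `s = ι_{χ₀} ⊗ ĉ` ([Weil64, n° 39]) and, from the smoothness of BOTH finite Weil representations
  --     (`ι_{χ₀}`: continuity, [BZ76, §2.1]; `s`: hypothesis, read through `ι`), `ĉ ∘ inl ∘ ι` trivial on an open subgroup of `G`
  obtain ⟨ĉ, hsĉ, -, -⟩ := UnitaryDualPair.WeilCoinv.exists_eq_twist_of_isCompatible (↥(maximalRealSubfield (L : Type))) (L : Type)
      (IsCMField.complexConj (L : Type)) 3 1 e₁ (Matrix.diagonal (frameD V)) (Matrix.diagonal (RealScalar.vec a))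
      (complexConj_imagUnit (L : Type)) (imagUnit_ne_zero (L : Type)) (imagUnit_mul_self (L : Type))
      (realDiagonal_isSymm (L : Type) (frameD V) (frameD_real V)) (realDiagonal_isSymm (L : Type) (RealScalar.vec a) (RealScalar.vec_real a))
      (isUnit_det_realDiagonal (L : Type) (frameD V) (frameD_real V) (frameD_ne V))
      (isUnit_det_realDiagonal (L : Type) (RealScalar.vec a) (RealScalar.vec_real a) (RealScalar.vec_ne a))
      (realDiagonal_map (L : Type) (frameD V) (frameD_real V)).symm
      (realDiagonal_map (L : Type) (RealScalar.vec a) (RealScalar.vec_real a)).symm hs₀ hs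
  subst hsĉ
  obtain ⟨K, hK, hK1⟩ : ∃ K : Subgroup G, IsOpen (K : Set G) ∧ ∀ g ∈ K,
      UnitaryDualPair.WeilCoinv.twistCharV (↥(maximalRealSubfield (L : Type))) (L : Type) (IsCMField.complexConj (L : Type)) 3 1
        (Matrix.diagonal (frameD V)) (Matrix.diagonal (RealScalar.vec a)) ĉ (ι g) = 1 := by
    refine UnitaryDualPair.WeilCoinv.exists_isOpen_forall_twistCharV_comp_eq_one_of_smooth (↥(maximalRealSubfield (L : Type))) (L : Type)
      (IsCMField.complexConj (L : Type)) 3 1 e₁ (Matrix.diagonal (frameD V)) (Matrix.diagonal (RealScalar.vec a))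
      (complexConj_imagUnit (L : Type)) (imagUnit_ne_zero (L : Type)) (imagUnit_mul_self (L : Type))
      (realDiagonal_isSymm (L : Type) (frameD V) (frameD_real V)) (realDiagonal_isSymm (L : Type) (RealScalar.vec a) (RealScalar.vec_real a))
      (isUnit_det_realDiagonal (L : Type) (frameD V) (frameD_real V) (frameD_ne V))
      (isUnit_det_realDiagonal (L : Type) (RealScalar.vec a) (RealScalar.vec_real a) (RealScalar.vec_ne a))
      (realDiagonal_map (L : Type) (frameD V) (frameD_real V)).symm
      (realDiagonal_map (L : Type) (RealScalar.vec a) (RealScalar.vec_real a)).symm ι ĉ hs₀ hs (fun v => ?_) hsmV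
    obtain ⟨K, hK, -, h⟩ := UnitaryDualPair.WeilCoinv.exists_isOpen_isCompact_forall_finPairRepV_apply_eq_self (↥(maximalRealSubfield (L : Type))) (L : Type)
      (IsCMField.complexConj (L : Type)) 3 1 e₁ (Matrix.diagonal (frameD V)) (Matrix.diagonal (RealScalar.vec a))
      (complexConj_imagUnit (L : Type)) (imagUnit_ne_zero (L : Type)) (imagUnit_mul_self (L : Type))
      (realDiagonal_isSymm (L : Type) (frameD V) (frameD_real V)) (realDiagonal_isSymm (L : Type) (RealScalar.vec a) (RealScalar.vec_real a))
      (isUnit_det_realDiagonal (L : Type) (frameD V) (frameD_real V) (frameD_ne V))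
      (isUnit_det_realDiagonal (L : Type) (RealScalar.vec a) (RealScalar.vec_real a) (RealScalar.vec_ne a))
      (realDiagonal_map (L : Type) (frameD V) (frameD_real V)).symm
      (realDiagonal_map (L : Type) (RealScalar.vec a) (RealScalar.vec_real a)).symm hsc₀ hs₀ v
    refine ⟨K.comap ι, ?_, fun g hg => h (ι g) (Subgroup.mem_comap.1 hg)⟩
    rw [Subgroup.coe_comap]
    exact hK.preimage hι
  -- (3) on the archimedean centre `ĉ` is the continuous character `archWeight L (m − centralType (1,…,1))` (the two central types)
  have hval : ∀ y : ↥(Literature.NumberTheory.Automorphic.relNormOneInfUnits (↥(maximalRealSubfield (L : Type))) (L : Type)),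
      ((ĉ (UnitaryGroup.adelicInl (↥(maximalRealSubfield (L : Type))) (L : Type) (IsCMField.complexConj (L : Type)) 3 1
        (Matrix.diagonal (frameD V)) (Matrix.diagonal (RealScalar.vec a))
        (UnitaryGroup.archToAdelic (↥(maximalRealSubfield (L : Type))) (L : Type) (IsCMField.complexConj (L : Type)) 3 (Matrix.diagonal (frameD V))
          (UnitaryGroup.cmArchCenter (L : Type) 3 (Matrix.diagonal (frameD V)) y))) : ℂˣ) : ℂ) =
        Literature.NumberTheory.Automorphic.archWeight (L : Type)
          (m - centralType (L : Type) e₁ (frameD V) (frameD_real V) (RealScalar.vec a) (RealScalar.vec_real a) (fun _ => (1 : ℤ))) y := by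
    intro y
    obtain ⟨x₀, hx₀⟩ := exists_testFun_gaussianAt_ne_zero V a
    have h1 := hP y x₀ 1
    have h0 := hP₀ y x₀ 1
    rw [UnitaryDualPair.WeilCoinv.pairRep_twist_apply] at h1
    dsimp only at h1
    -- the CM junction `(y · 1₃)^𝔸 = (y, 1) · 1_V` (Literature `UnitaryGroup.archToAdelic_cmArchCenter`, read with the pair's `CMCenter`)
    have hc : UnitaryGroup.archToAdelic (↥(maximalRealSubfield (L : Type))) (L : Type) (IsCMField.complexConj (L : Type)) 3
          (Matrix.diagonal (frameD V)) (UnitaryGroup.cmArchCenter (L : Type) 3 (Matrix.diagonal (frameD V)) y) =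
        CMCenter (L : Type) (frameD V) ((UnitaryGroup.cmAdelicOneEquivRelNormOne (L : Type)).symm
          (Literature.NumberTheory.Automorphic.relNormOneInfToIdeles (↥(maximalRealSubfield L)) L y)) :=
      UnitaryGroup.archToAdelic_cmArchCenter (L : Type) 3 (Matrix.diagonal (frameD V)) y
    rw [h0, smul_smul, map_one, mul_one, ← hc] at h1
    have h2 := smul_left_injective ℂ hx₀ h1
    have hne : Literature.NumberTheory.Automorphic.archWeight (L : Type)
        (centralType (L : Type) e₁ (frameD V) (frameD_real V) (RealScalar.vec a) (RealScalar.vec_real a) (fun _ => (1 : ℤ))) y ≠ 0 :=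
      fun h => by
      have := Literature.NumberTheory.Automorphic.norm_archWeight (L : Type)
        (centralType (L : Type) e₁ (frameD V) (frameD_real V) (RealScalar.vec a) (RealScalar.vec_real a) (fun _ => (1 : ℤ))) y
      rw [h, norm_zero] at this
      exact zero_ne_one this
    rw [sub_eq_add_neg, Literature.NumberTheory.Automorphic.archWeight_add, Literature.NumberTheory.Automorphic.archWeight_neg,
      ← div_eq_mul_inv, eq_div_iff hne]
    exact h2
  have hcen : Continuous fun y : ↥(Literature.NumberTheory.Automorphic.relNormOneInfUnits (↥(maximalRealSubfield (L : Type))) (L : Type)) =>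
      ĉ (UnitaryGroup.adelicInl (↥(maximalRealSubfield (L : Type))) (L : Type) (IsCMField.complexConj (L : Type)) 3 1
        (Matrix.diagonal (frameD V)) (Matrix.diagonal (RealScalar.vec a))
        (UnitaryGroup.archToAdelic (↥(maximalRealSubfield (L : Type))) (L : Type) (IsCMField.complexConj (L : Type)) 3 (Matrix.diagonal (frameD V))
          (UnitaryGroup.cmArchCenter (L : Type) 3 (Matrix.diagonal (frameD V)) y))) := by
    refine Units.continuous_iff.2 ⟨?_, ?_⟩
    · simp only [Function.comp_def, hval]
      exact Literature.NumberTheory.Automorphic.continuous_archWeight (L : Type) _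
    · have hinv : ∀ y : ↥(Literature.NumberTheory.Automorphic.relNormOneInfUnits (↥(maximalRealSubfield (L : Type))) (L : Type)),
          (((ĉ (UnitaryGroup.adelicInl (↥(maximalRealSubfield (L : Type))) (L : Type) (IsCMField.complexConj (L : Type)) 3 1
            (Matrix.diagonal (frameD V)) (Matrix.diagonal (RealScalar.vec a))
            (UnitaryGroup.archToAdelic (↥(maximalRealSubfield (L : Type))) (L : Type) (IsCMField.complexConj (L : Type)) 3
              (Matrix.diagonal (frameD V)) (UnitaryGroup.cmArchCenter (L : Type) 3 (Matrix.diagonal (frameD V)) y))))⁻¹ : ℂˣ) : ℂ) =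
            Literature.NumberTheory.Automorphic.archWeight (L : Type)
              (centralType (L : Type) e₁ (frameD V) (frameD_real V) (RealScalar.vec a) (RealScalar.vec_real a) (fun _ => (1 : ℤ)) - m) y :=
        fun y => by
        rw [Units.val_inv_eq_inv_val, hval, ← Literature.NumberTheory.Automorphic.archWeight_neg, neg_sub]
      simp only [hinv]
      exact Literature.NumberTheory.Automorphic.continuous_archWeight (L : Type) _
  -- (4) automatic continuity on `G₁(𝔸)`: the finite level is the image `ι(K)`, OPEN since `ι` is an open map, and `ĉ ∘ inl` is trivial on it
  have hlev : ∃ K' : Subgroup ↥(UnitaryGroup.finAdelic (↥(maximalRealSubfield (L : Type))) (L : Type)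
      (IsCMField.complexConj (L : Type)) 3 (Matrix.diagonal (frameD V))),
      IsOpen (K' : Set ↥(UnitaryGroup.finAdelic (↥(maximalRealSubfield (L : Type))) (L : Type) (IsCMField.complexConj (L : Type)) 3
        (Matrix.diagonal (frameD V)))) ∧
      ∀ k ∈ K', ĉ (UnitaryGroup.adelicInl (↥(maximalRealSubfield (L : Type))) (L : Type) (IsCMField.complexConj (L : Type)) 3 1
        (Matrix.diagonal (frameD V)) (Matrix.diagonal (RealScalar.vec a))
        (finAdelicToAdelic (↥(maximalRealSubfield (L : Type))) (L : Type) (IsCMField.complexConj (L : Type)) 3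
          (Matrix.diagonal (frameD V)) k)) = 1 := by
    refine ⟨K.map ι, ?_, ?_⟩
    · rw [Subgroup.coe_map]
      exact hιo _ hK
    · rintro _ ⟨g, hg, rfl⟩
      exact hK1 g hg
  have hĉ : Continuous ĉ :=
    AdelicContinuity.continuous_pair_of_level_of_continuous_centre (L : Type) (frameD V) (frameD_real V) (frameD_ne V)
      (Matrix.diagonal (RealScalar.vec a)) (by simpa using RealScalar.vec_ne a 0) ĉ hlev hcen
  -- (5) the twist of the continuous reference splitting by a continuous character is continuous ([Weil64, n° 39])
  exact adelicMpCont.continuous_twist _ ĉ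
    (continuous_chiSplittingLine (L : Type) e₁ (frameD V) (frameD_real V) (frameD_ne V) (toHeckeCharacter (L : Type) ψ) hχu hχs
      (realDiagonal (L : Type) (RealScalar.vec a) (RealScalar.vec_real a))
      (isUnit_det_realDiagonal (L : Type) (RealScalar.vec a) (RealScalar.vec_real a) (RealScalar.vec_ne a))
      (Matrix.diagonal (RealScalar.vec a)) (realDiagonal_map (L : Type) (RealScalar.vec a) (RealScalar.vec_real a)).symm)
    (Units.continuous_val.comp hĉ)

end Summit.HodgeConjecture.CorCM.Transposition.CentralTypeAtPin

end
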